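import Summits.ValiantsHypothesis.ValiantsHypothesis.Theorems.MonotoneRestorationOrbitRestorationQPValueOrbitClosure
import HarnessLib

/-!
# Finite sums and products of orbit-restorable polynomials at UNIFORM cost (symmetrisation in ORBIT currency)

Route MonotoneRestoration, crux `OrbitRestorationQP` (stmt-ValiantsHypothesis-18293), namespace
`Summit.ValiantsHypothesis.ValiantsHypothesis.Theorems.ValueOrbit`.

`…ValueOrbitClosure.lean` closes `QPOrbitRestorable c n` under ONE sum / product at cost `c ↦ c + 3`, and
`…Restorable.lean` (`qpOrbitRestorable_sum`) iterates this at cost `3` PER SUMMAND — useless for sums with a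
growing number of terms.  But in value-orbit currency the number of terms is irrelevant: merging the value
derivations of the summands and adjoining the partial sums (each an INVARIANT polynomial, orbit `1`) keeps
every value orbit within the same bound.  Hence

* `qpOrbitRestorable_finset_sum` — **`Σ_{i ∈ s} p_i` is `QPOrbitRestorable (c + 3)` whenever every `p_i` is
  `QPOrbitRestorable c`, for a finite index set `s` of ANY size;**
* `qpOrbitRestorable_finset_prod` — the same for `Π_{i ∈ s} p_i`.

Everything is proved. [folklore]
-/

noncomputable section

open scoped Classical

-- `Summit.ValiantsHypothesis.ValiantsHypothesis.…` is the tree's single-conjunct layout (Sub = Summit).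
set_option linter.dupNamespace false

namespace Summit.ValiantsHypothesis.ValiantsHypothesis.Theorems

namespace ValueOrbit

open Literature.Computability.AlgebraicComplexity OrbitRestorationQPDepthThreeRung

variable {n : ℕ}

/-- A one-value derivation of a constant (all orbits of size `1`). [folklore] -/
theorem exists_valueDerivation_C (a : ℂ) : ∃ 𝒟 : ValueDerivation ℂ (Fin n × Fin n),
    MvPolynomial.C a ∈ 𝒟.S ∧
      ∀ q ∈ 𝒟.S, (Set.range fun σ : Equiv.Perm (Fin n) => ren σ q).ncard ≤ 1 := by
  refine ⟨⟨{MvPolynomial.C a}, fun _ => 0, fun q hq => ⟨StepData.const a, ⟨?_, fun u hu => ?_⟩⟩⟩,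
    Finset.mem_singleton_self _, fun q hq => ?_⟩
  · rw [Finset.mem_singleton] at hq; rw [hq]; rfl
  · simp [StepData.args] at hu
  · have hq' : q = MvPolynomial.C a := Finset.mem_singleton.mp hq
    subst hq'
    exact ncard_orbit_of_invariant fun σ => ren_C σ a

/-- **FINITE SUMS AT UNIFORM COST.**  If every `p i`, `i ∈ s`, is `QPOrbitRestorable c n`, then
`Σ_{i ∈ s} p i` is `QPOrbitRestorable (c + 3) n` — independently of the size of `s`. [folklore] -/
theorem qpOrbitRestorable_finset_sum {c : ℕ} {ι : Type*} (s : Finset ι)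
    (p : ι → MvPolynomial (Fin n × Fin n) ℂ) (hp : ∀ i ∈ s, QPOrbitRestorable c n (p i)) :
    QPOrbitRestorable (c + 3) n (∑ i ∈ s, p i) := by
  set B := 2 ^ ((Nat.log 2 n + c) ^ c) with hB
  have hB1 : 1 ≤ B := Nat.one_le_two_pow
  have key : ∀ t : Finset ι, t ⊆ s → ∃ 𝒟 : ValueDerivation ℂ (Fin n × Fin n), (∑ i ∈ t, p i) ∈ 𝒟.S ∧
      (∀ σ : Equiv.Perm (Fin n), ren σ (∑ i ∈ t, p i) = ∑ i ∈ t, p i) ∧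
      ∀ q ∈ 𝒟.S, (Set.range fun σ : Equiv.Perm (Fin n) => ren σ q).ncard ≤ B := by
    intro t
    induction t using Finset.induction_on with
    | empty =>
      intro _
      obtain ⟨𝒟, h0, hS⟩ := exists_valueDerivation_C (n := n) 0
      refine ⟨𝒟, ?_, fun σ => by rw [Finset.sum_empty, map_zero], fun q hq => (hS q hq).trans hB1⟩
      rw [Finset.sum_empty, ← MvPolynomial.C_0]; exact h0
    | insert a t hat ih =>
      intro hts
      obtain ⟨𝒟, hmem, hinv, hS⟩ := ih ((Finset.subset_insert a t).trans hts)
      obtain ⟨hinva, 𝒟a, hma, hSa⟩ :=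
        exists_valueDerivation_of_qpOrbitRestorable (hp a (hts (Finset.mem_insert_self a t)))
      refine ⟨(𝒟a.union 𝒟).addStep (p a) (∑ i ∈ t, p i) (ValueDerivation.mem_union_S_left hma)
        (ValueDerivation.mem_union_S_right hmem), ?_, fun σ => ?_, fun q hq => ?_⟩
      · rw [Finset.sum_insert hat]
        exact ValueDerivation.mem_addStep_S.2 (Or.inl rfl)
      · rw [Finset.sum_insert hat, map_add, hinva, hinv]
      · rcases ValueDerivation.mem_addStep_S.1 hq with rfl | hq
        · refine (ncard_orbit_of_invariant fun σ => ?_).trans hB1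
          rw [map_add, hinva, hinv]
        rcases ValueDerivation.mem_union_S.1 hq with hq | hq
        · exact hSa q hq
        · exact hS q hq
  obtain ⟨𝒟, hmem, hinv, hS⟩ := key s le_rfl
  unfold QPOrbitRestorable
  exact qpOrbit_of_valueDerivation 𝒟 hmem hinv hS

/-- **FINITE PRODUCTS AT UNIFORM COST.**  If every `p i`, `i ∈ s`, is `QPOrbitRestorable c n`, then
`Π_{i ∈ s} p i` is `QPOrbitRestorable (c + 3) n` — independently of the size of `s`. [folklore] -/
theorem qpOrbitRestorable_finset_prod {c : ℕ} {ι : Type*} (s : Finset ι)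
    (p : ι → MvPolynomial (Fin n × Fin n) ℂ) (hp : ∀ i ∈ s, QPOrbitRestorable c n (p i)) :
    QPOrbitRestorable (c + 3) n (∏ i ∈ s, p i) := by
  set B := 2 ^ ((Nat.log 2 n + c) ^ c) with hB
  have hB1 : 1 ≤ B := Nat.one_le_two_pow
  have key : ∀ t : Finset ι, t ⊆ s → ∃ 𝒟 : ValueDerivation ℂ (Fin n × Fin n), (∏ i ∈ t, p i) ∈ 𝒟.S ∧
      (∀ σ : Equiv.Perm (Fin n), ren σ (∏ i ∈ t, p i) = ∏ i ∈ t, p i) ∧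
      ∀ q ∈ 𝒟.S, (Set.range fun σ : Equiv.Perm (Fin n) => ren σ q).ncard ≤ B := by
    intro t
    induction t using Finset.induction_on with
    | empty =>
      intro _
      obtain ⟨𝒟, h1, hS⟩ := exists_valueDerivation_C (n := n) 1
      refine ⟨𝒟, ?_, fun σ => by rw [Finset.prod_empty, map_one], fun q hq => (hS q hq).trans hB1⟩
      rw [Finset.prod_empty, ← MvPolynomial.C_1]; exact h1
    | insert a t hat ih =>
      intro hts
      obtain ⟨𝒟, hmem, hinv, hS⟩ := ih ((Finset.subset_insert a t).trans hts)
      obtain ⟨hinva, 𝒟a, hma, hSa⟩ :=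
        exists_valueDerivation_of_qpOrbitRestorable (hp a (hts (Finset.mem_insert_self a t)))
      refine ⟨(𝒟a.union 𝒟).mulStep (p a) (∏ i ∈ t, p i) (ValueDerivation.mem_union_S_left hma)
        (ValueDerivation.mem_union_S_right hmem), ?_, fun σ => ?_, fun q hq => ?_⟩
      · rw [Finset.prod_insert hat]
        exact ValueDerivation.mem_mulStep_S.2 (Or.inl rfl)
      · rw [Finset.prod_insert hat, map_mul, hinva, hinv]
      · rcases ValueDerivation.mem_mulStep_S.1 hq with rfl | hq
        · refine (ncard_orbit_of_invariant fun σ => ?_).trans hB1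
          rw [map_mul, hinva, hinv]
        rcases ValueDerivation.mem_union_S.1 hq with hq | hq
        · exact hSa q hq
        · exact hS q hq
  obtain ⟨𝒟, hmem, hinv, hS⟩ := key s le_rfl
  unfold QPOrbitRestorable
  exact qpOrbit_of_valueDerivation 𝒟 hmem hinv hS

end ValueOrbit

end Summit.ValiantsHypothesis.ValiantsHypothesis.Theorems

end
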